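import Summits.AnomalousDissipation.AnomalousDissipation.Theorems.SolenoidalFractalHomogenisationLagrangianStepVmodDistortedDefs

/-!
# CERTIFIER SKETCH (planner ad-ideate-p5 g15, finding F-p5g15-1): the GRADED re-typing of (V_θ)

`SlowVectorClauseFθ … θV` (p711553) asks the cell member at a frozen unimodular deformation `G₀` (= the flat cell problem of the
AFFINELY DEFORMED word: wavevectors `G₀ᵀ m_j`, amplitudes `G₀⁻¹ ê_j`) to match the coarse member built from the `G₀`-INDEPENDENT
renormalised tensor `Φ ν ((1/ν)•𝔸)` (= the UNDEFORMED word's homogenised symbol) within (V)'s allowance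
`C(C(ν^σ + ρ_ℓ^σ) min(1,Rt) + R·P)`, which → 0 in the regime ν → 0, n ≫ |ℓ|⌈K/ν⌉.  The deformed word's realised slow symbol differs
from the undeformed one by a ν-FREE relative `O(θ)` (transverse ANISOTROPY `‖Δ‖ ≈ 0.097 θ` at `ℓ = e₃`, `G₀ = 1 + θ e₁⊗e₂`, up to
`0.77 θ` over directions; kit j329593/j329633), so the secular drift `‖w_ℓ − v_ℓ‖ ≈ ‖Δ‖·Rt·e^{−Rt}` has the ν-free floor `‖Δ‖/e`
(1.74e-3·‖p‖ at θ = 0.05, ν = 1e-4, every X = |ℓ|/(νn) ∈ {1/4, 1/16}) and the clause is FALSE for every θV > 0.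
REPAIR (architecture-compatible: `SlowVectorClauseModECW0` / `BlockBoundG` already carry the graded slot `θ ^ σ` under
`∀ θ ∈ Set.Icc 0 θ₁`): grade the family by the ACTUAL deformation and pay `θ ^ σ` inside the `min 1 (R t)` bracket.
-/

set_option linter.dupNamespace false

noncomputable section

namespace Summit.AnomalousDissipation.AnomalousDissipation.Theorems.SolenoidalFractalHomogenisation.LagrangianStep.VmodDist

open Literature.Analysis Literature.Analysis.FluidPDE Literature.Analysis.FunctionSpaces
open MeasureTheory Set
open scoped InnerProductSpace

/-- **(V_θ) GRADED `SlowVectorClauseFθg … θV`** — `SlowVectorClauseFθ` with (i) the family graded by the actual entrywise deformation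
`θ ∈ [0, θV]` of `G₀` and (ii) the deformation allowance `θ ^ σ` added to `ν ^ σ + ρ_ℓ ^ σ` inside the `min 1 (R t)` bracket (the secular
symbol-mismatch drift of the deformed cell word against the undeformed coarse tensor; true even with `θ` linear).  At `θ = 0` (so `G₀ = 1`,
`0 ^ σ = 0`) it is (V)'s conclusion verbatim. -/
def SlowVectorClauseFθg {k : ℕ} (W : LatticeShear.LatticeWord k) (M : ℝ) (hM : 0 < M) (c : ℝ)
    (Φ : ℝ → Torus.Visc4 (Fin 3) → Torus.Visc4 (Fin 3)) (lo hi Λ β σ C ν₀ K θV : ℝ) : Prop :=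
  ∀ θ ∈ Set.Icc 0 θV, ∀ G₀ : Matrix (Fin 3) (Fin 3) ℝ, G₀.det = 1 → (∀ i j, |G₀ i j - (1 : Matrix (Fin 3) (Fin 3) ℝ) i j| ≤ θ) →
      ∀ ν, ∀ hν : ν ∈ Set.Ioo 0 ν₀, ∀ n : ℕ, ∀ 𝔸 : Torus.Visc4 (Fin 3),
        Torus.OddSmall 𝔸 (ν * β) → (∃ lam ∈ Set.Icc (1:ℝ) Λ, Torus.NearIso 𝔸 (ν * (lo / lam)) (ν * (hi * lam))) →
        ∀ ℓ : Fin 3 → ℤ, ℓ ≠ 0 → ‖Torus.latticeVec ℓ‖ * (⌈K / ν⌉₊ : ℝ) ≤ n →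
        ∀ p : EuclideanSpace ℝ (Fin 3), ‖p‖ = 1 →
          ⟪(WithLp.toLp 2 (G₀.mulVec (WithLp.ofLp p)) : EuclideanSpace ℝ (Fin 3)), Torus.latticeVec ℓ⟫_ℝ = 0 →
        ∀ T > (0:ℝ),
          ∀ w v : ℝ → VF,
            Torus.IsWeakTensorPassiveVectorDistortedOn 0 T ((1 / (n:ℝ) ^ 2) • 𝔸) (cellField W M hM ν hν.1 n) (fun _ _ => G₀)
                (fun x => (UnitAddTorus.mFourier ℓ x).re • p) w →
            Torus.IsWeakTensorPassiveVectorDistortedOn 0 (2 * T) ((1 / (n:ℝ) ^ 2) • (𝔸 + (c / ν) • Φ ν ((1 / ν) • 𝔸))) (fun _ _ => 0) (fun _ _ => G₀)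
                (fun x => (UnitAddTorus.mFourier ℓ x).re • p) v →
            ∀ᵐ t ∂(volume.restrict (Ioo 0 T)),
              2 * ∑ i, ‖modeCoeff ℓ (fun x => w t x - v t x) i‖ ^ 2
                  ≤ (C * (C * (ν ^ σ + (‖Torus.latticeVec ℓ‖ * (⌈K / ν⌉₊ : ℝ) / n) ^ σ + θ ^ σ) * min 1 ((8 * Real.pi ^ 2 * ‖Torus.latticeVec ℓ‖ ^ 2 * (hi * Λ) * (ν + c / ν) / (n:ℝ) ^ 2) * t) + (8 * Real.pi ^ 2 * ‖Torus.latticeVec ℓ‖ ^ 2 * (hi * Λ) * (ν + c / ν) / (n:ℝ) ^ 2) * (M * W.period / ν))) ^ 2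
                      * ∫ x, ‖(UnitAddTorus.mFourier ℓ x).re • p‖ ^ 2

/-- The graded family is antitone in the radius. -/
theorem SlowVectorClauseFθg.mono_θV {k : ℕ} {W : LatticeShear.LatticeWord k} {M : ℝ} {hM : 0 < M} {c : ℝ}
    {Φ : ℝ → Torus.Visc4 (Fin 3) → Torus.Visc4 (Fin 3)} {lo hi Λ β σ C ν₀ K θV θV' : ℝ} (hle : θV' ≤ θV)
    (h : SlowVectorClauseFθg W M hM c Φ lo hi Λ β σ C ν₀ K θV) : SlowVectorClauseFθg W M hM c Φ lo hi Λ β σ C ν₀ K θV' :=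
  fun θ hθ => h θ ⟨hθ.1, hθ.2.trans hle⟩

/-- ANCHOR: the `θ = 0` member of the graded family is the ungraded (V_θ) at radius `0` (hence, by `noExF_of_clauseFθ le_rfl`
(…VmodThetaRung), the (V) clause without existence): `0 ^ σ = 0` for `σ ≠ 0`. -/
theorem clauseFθ_zero_of_clauseFθg {k : ℕ} {W : LatticeShear.LatticeWord k} {M : ℝ} {hM : 0 < M} {c : ℝ}
    {Φ : ℝ → Torus.Visc4 (Fin 3) → Torus.Visc4 (Fin 3)} {lo hi Λ β σ C ν₀ K θV : ℝ} (hσ : 0 < σ) (hθV : 0 ≤ θV)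
    (h : SlowVectorClauseFθg W M hM c Φ lo hi Λ β σ C ν₀ K θV) : SlowVectorClauseFθ W M hM c Φ lo hi Λ β σ C ν₀ K 0 := by
  intro G₀ hdet hG ν hν n 𝔸 h1 h2 ℓ hℓ hres p hp hperp T hT w v hw hv
  have key := h 0 ⟨le_rfl, hθV⟩ G₀ hdet hG ν hν n 𝔸 h1 h2 ℓ hℓ hres p hp hperp T hT w v hw hv
  have h0 : (0:ℝ) ^ σ = 0 := Real.zero_rpow hσ.ne'
  simp only [h0, add_zero] at key
  exact key

end Summit.AnomalousDissipation.AnomalousDissipation.Theorems.SolenoidalFractalHomogenisation.LagrangianStep.VmodDist
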